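import Literature.Geometry.GeometricMeasureTheory.ApproxTangentLipschitz
import HarnessLib

/-!
# Weak limits of blow-ups are supported in the tangent cone of the carrier

Federer [Federer1969, 4.3.16]: if `C` is an oriented tangent cone of `T` at `b` (a limit of
`(μ_{r_j} ∘ τ_{-b})_# T`, `r_j → ∞`), then "clearly this implies `spt C ⊆ Tan(spt T, b)`". Here for
the currents of integration built from blown-up data (the shape of `HolomorphicChain.blowUp`):
`D_r = [A_r⁻¹W ∩ B(0,1), θ ∘ A_r, ξ ∘ A_r]`, `A_r y = b + r y`, read on any open set `Ω`:

* `currentOfIntegration_apply_eq_zero_of_disjoint` — a current of integration vanishes on test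
  forms whose support misses the carrier (honest or junk value alike);
* `exists_nhds_forall_add_smul_notMem_of_notMem_posTangentConeAt` — if `w ∉ Tan(W, b)`
  (Mathlib's `posTangentConeAt W b`) then `b + r u ∉ W` for all `u` near `w` and all small `r > 0`
  (from the cone-neighbourhood form `exists_forall_le_norm_smul_sub_of_notMem_posTangentConeAt`);
* `support_subset_posTangentConeAt_of_tendsto` — **if `r_i → 0⁺` and `D_{r_i} → C'` weakly, then
  `spt C' ⊆ Tan(W, b)`**.

No definitions, no named facts.

## References

* H. Federer, *Geometric Measure Theory*, Springer 1969, 3.1.21, 4.3.16 [Federer1969].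
-/

open scoped ENNReal NNReal Topology Distributions
open MeasureTheory TopologicalSpace Set Filter Metric

namespace Literature.Geometry.GeometricMeasureTheory

-- Nested operator-norm instances on (duals of) `E [⋀^Fin m]→L[ℝ] ℝ`, as in `Currents.lean`.
set_option maxSynthPendingDepth 2

variable {V : Type*} [NormedAddCommGroup V] [NormedSpace ℝ V]

/-- **Off the tangent cone, small dilates miss the set**: if `w ∉ Tan(W, b)` then there are a
neighbourhood `U` of `w` and `r₁ > 0` with `b + r u ∉ W` for all `u ∈ U`, `0 < r < r₁`.
[cite: Federer1969, 3.1.21] -/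
theorem exists_nhds_forall_add_smul_notMem_of_notMem_posTangentConeAt {W : Set V} {b w : V}
    (hw : w ∉ posTangentConeAt W b) :
    ∃ U ∈ 𝓝 w, ∃ r₁ : ℝ, 0 < r₁ ∧ ∀ r : ℝ, 0 < r → r < r₁ → ∀ u ∈ U, b + r • u ∉ W := by
  obtain ⟨ε, hε, δ, hδ, hcone⟩ := exists_forall_le_norm_smul_sub_of_notMem_posTangentConeAt hw
  have hpos : 0 < ‖w‖ + ε := by positivity
  refine ⟨Metric.ball w ε, Metric.ball_mem_nhds w hε, δ / (‖w‖ + ε), div_pos hδ hpos,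
    fun r hr hr₁ u hu hmem => ?_⟩
  have hu' : ‖u‖ < ‖w‖ + ε := by
    have h1 : ‖u - w‖ < ε := by rwa [← dist_eq_norm, ← Metric.mem_ball]
    calc ‖u‖ = ‖w + (u - w)‖ := by rw [add_sub_cancel]
      _ ≤ ‖w‖ + ‖u - w‖ := norm_add_le _ _
      _ < ‖w‖ + ε := by linarith
  -- `d = r • u` is short and `b + d ∈ W`, so the cone inequality with `c = r⁻¹` fails
  have hd : ‖r • u‖ < δ := by
    rw [norm_smul, Real.norm_of_nonneg hr.le]
    calc r * ‖u‖ ≤ r * (‖w‖ + ε) := by gcongr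
      _ < δ / (‖w‖ + ε) * (‖w‖ + ε) := by gcongr
      _ = δ := div_mul_cancel₀ δ hpos.ne'
  have h := hcone (r • u) hd hmem r⁻¹ (inv_nonneg.2 hr.le)
  rw [smul_smul, inv_mul_cancel₀ hr.ne', one_smul] at h
  have h2 : ‖u - w‖ < ε := by rwa [← dist_eq_norm, ← Metric.mem_ball]
  linarith

section Integration

variable [MeasurableSpace V] [BorelSpace V] {Ω : Opens V} {m : ℕ}

/-- A current of integration vanishes on test forms whose support misses the carrier (whether or
not the data are summable: the junk value is `0` too). [cite: Federer1969, 4.1.7] -/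
theorem currentOfIntegration_apply_eq_zero_of_disjoint {W : Set V} {θ : V → ℤ} {ξ : V → Fin m → V}
    (φ : TestForm Ω m) (h : Disjoint W (tsupport ⇑φ)) :
    (currentOfIntegration W θ ξ : Current Ω m) φ = 0 := by
  by_cases hint : LocallyIntegrableOn (fun x => (θ x : ℝ) • frameVector (ξ x)) (Ω : Set V)
      ((μHE[m] : Measure V).restrict W)
  · rw [currentOfIntegration_apply hint]
    refine setIntegral_eq_zero_of_forall_eq_zero fun x hx => ?_
    have hx' : x ∉ tsupport ⇑φ := fun hx' => Set.disjoint_left.1 h hx hx'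
    rw [image_eq_zero_of_notMem_tsupport hx', ContinuousAlternatingMap.coe_zero, Pi.zero_apply,
      mul_zero]
  · rw [currentOfIntegration, vectorCurrent_of_not_locallyIntegrableOn hint,
      zero_apply]

/-- **Weak limits of blow-ups are supported in the tangent cone of the carrier** ("clearly this
implies `spt C ⊆ Tan(spt T, b)`"): if `rᵢ → 0⁺` and the blown-up currents of integration
`D_{rᵢ} = [A_{rᵢ}⁻¹W ∩ B(0,1), θ ∘ A_{rᵢ}, ξ ∘ A_{rᵢ}]` (`A_r y = b + r y`), read on `Ω`, converge
weakly to `C'`, then `spt C' ⊆ Tan(W, b)`: off the cone a whole neighbourhood is missed by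
`A_{rᵢ}⁻¹W` for large `i`, so `D_{rᵢ}` and hence `C'` vanish on forms supported there.
[cite: Federer1969, 4.3.16] -/
theorem support_subset_posTangentConeAt_of_tendsto {W : Set V} {θ : V → ℤ} {ξ : V → Fin m → V}
    {b : V} {rseq : ℕ → ℝ} (hpos : ∀ i, 0 < rseq i) (hlim : Tendsto rseq atTop (𝓝 0))
    {C' : Current Ω m}
    (hconv : ∀ φ : TestForm Ω m, Tendsto (fun i =>
      (currentOfIntegration ((fun y : V => b + rseq i • y) ⁻¹' W ∩ Metric.ball (0 : V) 1)
        (fun y => θ (b + rseq i • y)) (fun y => ξ (b + rseq i • y)) : Current Ω m) φ)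
      atTop (𝓝 (C' φ))) :
    C'.support ⊆ posTangentConeAt W b := by
  intro w hw
  by_contra hwc
  obtain ⟨U, hU, r₁, hr₁, hmiss⟩ := exists_nhds_forall_add_smul_notMem_of_notMem_posTangentConeAt hwc
  obtain ⟨φ, hφU, hφ⟩ := hw.2 U hU
  -- for large `i` the carrier of `D_{rᵢ}` misses `U ⊇ tsupport φ`, so `D_{rᵢ} φ = 0`
  have hev : ∀ᶠ i in atTop,
      (currentOfIntegration ((fun y : V => b + rseq i • y) ⁻¹' W ∩ Metric.ball (0 : V) 1)
        (fun y => θ (b + rseq i • y)) (fun y => ξ (b + rseq i • y)) : Current Ω m) φ = 0 := by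
    have hsmall : ∀ᶠ i in atTop, rseq i < r₁ := hlim (Iio_mem_nhds hr₁)
    filter_upwards [hsmall] with i hi
    refine currentOfIntegration_apply_eq_zero_of_disjoint φ (Set.disjoint_left.2 ?_)
    rintro u ⟨huW, -⟩ huφ
    exact hmiss (rseq i) (hpos i) hi u (hφU huφ) huW
  have h0 : C' φ = 0 :=
    tendsto_nhds_unique (hconv φ) (tendsto_const_nhds.congr' (hev.mono fun i hi => hi.symm))
  exact hφ h0

end Integration

end Literature.Geometry.GeometricMeasureTheory
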